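import Summits.RiemannHypothesis.RiemannHypothesis.Theorems.SemilocalNegCertEleven
import Summits.RiemannHypothesis.RiemannHypothesis.Theorems.SemilocalLogAtomsB
import HarnessLib

/-!
# Semi-local threshold of the `{∞,2,…,19}` form, negative side: `a*({2,…,19}) ≤ 203/128` (the wall `P = 23`)

Cell `rh-explicit` (HOME `run/shared/lean/pub/rh-explicit/`), seat cc-s2-4 gen7 (A4 SEMILOCAL-TABLE v0.6 extension, wall `P = 23`,
`S = S_23 = {2, 3, 5, 7, 11, 13, 17, 19}`; class `2, …, 19 ∈ S ∌ 23`).  Honest framing: theorems about the tree's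
`weilSemilocalThreshold S`; nothing here bears on RH.  No data is trusted: nine kernel facts (`decide +kernel`, light) of the
PIECEWISE certificate `certNineteen` (`WeilNegCertP`; window `2b = 203/64 = 3.171875`, `log 24 − 2b = 0.0062`).

Instance data: window `N = 23` (`b < (log 24)/2`), atoms = the `S`-smooth prime powers `≤ 23`: `2, 3, 4, 5, 7, 8, 9, 11, 13, 16, 17, 19`
(`atomsNineteen`; enclosures in `SemilocalLogAtoms.lean` (`2 … 16`) and `SemilocalLogAtomsB.lean` (`17`, `19`; `log 19` to 11 decimals
from `19 = 16(1 + 3/16)`)).  Witness: bottom vector of the odd Legendre section `d = 13`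
at `b = 203/128` from this seat's exact-kappa polynomial-section finder (`HOME/cc-s2-4/gen7/polyfind.py`: Legendre sections,
autocorrelations evaluated in exact rational arithmetic, `∫ w·D` by Gauss–Legendre; it reproduces cc-s2-5's lineage-B engine to
7+ digits where both run — that engine's moment series diverges for `b > π/2`): `Re Q_S(G)/‖G‖² = −1.5066·10⁻³` ⇒
**`weilSemilocalThreshold {2,…,19} ≤ 203/128 = 1.5859375`** (kernel margin of the same size; seven pieces, `archMajorCL 10 4 5 u₀`).
Locality (`N = 23`): **`a*(S) = a*({2,…,19}) ∈ [0.8046, 203/128]` for every finite `S` with `2, …, 19 ∈ S`, `23 ∉ S`**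
(DATA, cc-s2-6 blind cycle #6, two engines: `a*({2,…,19}) ∈ (1.567900, 1.567925]`).  Folklore throughout.
-/

set_option autoImplicit false
set_option linter.dupNamespace false  -- the mandated namespace repeats `RiemannHypothesis`

noncomputable section

open Complex Filter Set MeasureTheory Topology
open scoped Real

namespace Summit.RiemannHypothesis.RiemannHypothesis.Theorems.SemilocalPolyWitness

open MeasureTheory Set Finset Real
open Literature.NumberTheory.LFunctions
open Summit.RiemannHypothesis.RiemannHypothesis.Theorems.MotivicDoor
open Summit.RiemannHypothesis.RiemannHypothesis.Theorems.MotivicDoor.SemilocalThreshold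
open Summit.RiemannHypothesis.RiemannHypothesis.Theorems.MotivicDoor.SemilocalMarkov
open LQ


/-! ### The atom table of the `{2, 3, 5, 7, 11, 13, 17, 19}`-form on windows `b < (log 24)/2` (`N = 23`) -/

/-- The atoms of the `{2, 3, 5, 7, 11, 13, 17, 19}`-form below `(log 24)/2`: `2, 3, 4, 5, 7, 8, 9, 11, 13, 16, 17, 19`. -/
def atomsNineteen : List (ℕ × AtomQ) := [atomTwo, atomThree, atomFour, atomFive, atomSeven, atomEight, atomNine, atomEleven, atomThirteen, atomSixteen, atomSeventeen, atomNineteen]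

/-- A rational lower bound of `log 24`. -/
def logSuccLoNineteen : ℚ := 3 * logTwoLo20 + logThreeLo

/-- **The atom table encloses `({2, 3, 5, 7, 11, 13, 17, 19}, 23)`.** -/
theorem atomsEnclose_Nineteen : AtomsEnclose {2, 3, 5, 7, 11, 13, 17, 19} 23 atomsNineteen logSuccLoNineteen where
  nodup := by decide
  lt_succ := by decide
  cover := by
    intro n hn hnot
    simp only [atomsNineteen, atomTwo, atomThree, atomFour, atomFive, atomSeven, atomEight, atomNine, atomEleven, atomThirteen, atomSixteen, atomSeventeen, atomNineteen, List.map_cons, List.map_nil, List.mem_cons,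
      List.not_mem_nil, or_false, not_or] at hnot
    have hn' : n < 24 := Finset.mem_range.1 hn
    interval_cases n
    · exact weilSemilocalCoeff_of_not_isPrimePow _ (by decide)
    · exact weilSemilocalCoeff_of_not_isPrimePow _ (by decide)
    · simp at hnot
    · simp at hnot
    · simp at hnot
    · simp at hnot
    · exact weilSemilocalCoeff_of_not_isPrimePow _ (by decide)
    · simp at hnot
    · simp at hnot
    · simp at hnot
    · exact weilSemilocalCoeff_of_not_isPrimePow _ (by decide)
    · simp at hnot
    · exact weilSemilocalCoeff_of_not_isPrimePow _ (by decide)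
    · simp at hnot
    · exact weilSemilocalCoeff_of_not_isPrimePow _ (by decide)
    · exact weilSemilocalCoeff_of_not_isPrimePow _ (not_isPrimePow_of_two_primes_dvd Nat.prime_three (by norm_num : Nat.Prime 5) (by norm_num) (by norm_num) (by norm_num))
    · simp at hnot
    · simp at hnot
    · exact weilSemilocalCoeff_of_not_isPrimePow _ (by decide)
    · simp at hnot
    · exact weilSemilocalCoeff_of_not_isPrimePow _ (by decide)
    · exact weilSemilocalCoeff_of_not_isPrimePow _ (not_isPrimePow_of_two_primes_dvd Nat.prime_three (by norm_num : Nat.Prime 7) (by norm_num) (by norm_num) (by norm_num))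
    · exact weilSemilocalCoeff_of_not_isPrimePow _ (by decide)
    · exact weilSemilocalCoeff_prime_of_not_mem (by norm_num) (by decide)
  encl := by
    intro na hna
    simp only [atomsNineteen, List.mem_cons, List.not_mem_nil, or_false] at hna
    rcases hna with rfl | rfl | rfl | rfl | rfl | rfl | rfl | rfl | rfl | rfl | rfl | rfl
    · exact atomTwo_encl (by decide)
    · exact atomThree_encl (by decide)
    · exact atomFour_encl (by decide)
    · exact atomFive_encl (by decide)
    · exact atomSeven_encl (by decide)
    · exact atomEight_encl (by decide)
    · exact atomNine_encl (by decide)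
    · exact atomEleven_encl (by decide)
    · exact atomThirteen_encl (by decide)
    · exact atomSixteen_encl (by decide)
    · exact atomSeventeen_encl (by decide)
    · exact atomNineteen_encl (by decide)
  logSucc := by
    have h2 := logTwoLo20_le
    have h3 := logThreeLo_le
    have h24 : Real.log (((23 : ℕ) : ℝ) + 1) = 3 * Real.log 2 + Real.log 3 := by
      rw [show ((23 : ℕ) : ℝ) + 1 = 2 ^ 3 * 3 by norm_num, Real.log_mul (by norm_num) (by norm_num), Real.log_pow]; push_cast; ring
    rw [h24, logSuccLoNineteen]; push_cast; linarith

/-! ### The certificates -/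

/-- The degree-13 witness at `b = 203 / 128` (bottom vector of the odd Legendre section d = 13 at b = 203/128, rounded to 8 digits; exact-kappa finder margin Re Q_S/‖G‖² = −1.5066·10⁻³), in powers of `x`. -/
def pNineteen : List ℚ :=
  [0, -365428373153 / 1624, 0, 20467199940751360 / 8365427, 0, -357368852064170409984 / 49247268749, 0, 126909915090610014400806912 / 14206014885142787, 0, -3077263661411131476823758602240 / 585415667401849109483, 0, 5101908282385659071528234234413056 / 3446342033994685707526421, 0, -22886728993223798479775522576610099200 / 142020308878887003321456282989]

/-- The piecewise certificate at `b = 203 / 128`: orders `(nA, mA, KA, Kt, nt, ne) = (10, 4, 5, 10, 40, 16)`, cuts `[1, 3 / 2, 19 / 10, 11 / 5, 5 / 2, 57 / 20, 203 / 64]`,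
claimed piece bounds and atom bound (exact rational values rounded up to integers). -/
def certNineteen : WeilNegCertP :=
  ⟨pNineteen, 203 / 128, 10, 4, 5, 10, 40, 16, atomsNineteen, logSuccLoNineteen,
   [1, 3 / 2, 19 / 10, 11 / 5, 5 / 2, 57 / 20, 203 / 64],
   [17198757508037690, 4448507397707529, 2401565796870321, 1601652059998367, 1095357598133042, 1692229597595675, 1090460181298298], 96057372349901049⟩

set_option maxHeartbeats 0 in
/-- kernel fact: side conditions and the final inequality of `certNineteen`. -/
theorem check_Nineteen_main : certNineteen.checkMain c0SharpQ = true := by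
  decide +kernel

set_option maxHeartbeats 0 in
/-- kernel fact: the atom side of `certNineteen`. -/
theorem check_Nineteen_atoms : certNineteen.checkAtoms = true := by
  decide +kernel

set_option maxHeartbeats 0 in
/-- kernel fact: piece `0` of `certNineteen`. -/
theorem check_Nineteen_piece0 : certNineteen.checkPiece 0 = true := by
  decide +kernel

set_option maxHeartbeats 0 in
/-- kernel fact: piece `1` of `certNineteen`. -/
theorem check_Nineteen_piece1 : certNineteen.checkPiece 1 = true := by
  decide +kernel

set_option maxHeartbeats 0 in
/-- kernel fact: piece `2` of `certNineteen`. -/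
theorem check_Nineteen_piece2 : certNineteen.checkPiece 2 = true := by
  decide +kernel

set_option maxHeartbeats 0 in
/-- kernel fact: piece `3` of `certNineteen`. -/
theorem check_Nineteen_piece3 : certNineteen.checkPiece 3 = true := by
  decide +kernel

set_option maxHeartbeats 0 in
/-- kernel fact: piece `4` of `certNineteen`. -/
theorem check_Nineteen_piece4 : certNineteen.checkPiece 4 = true := by
  decide +kernel

set_option maxHeartbeats 0 in
/-- kernel fact: piece `5` of `certNineteen`. -/
theorem check_Nineteen_piece5 : certNineteen.checkPiece 5 = true := by
  decide +kernel

set_option maxHeartbeats 0 in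
/-- kernel fact: piece `6` of `certNineteen`. -/
theorem check_Nineteen_piece6 : certNineteen.checkPiece 6 = true := by
  decide +kernel

/-- all pieces of `certNineteen` check. -/
theorem check_Nineteen_pieces : ∀ i, i < certNineteen.cuts.length → certNineteen.checkPiece i = true := by
  intro i hi
  have hi' : i < 7 := hi
  interval_cases i
  · exact check_Nineteen_piece0
  · exact check_Nineteen_piece1
  · exact check_Nineteen_piece2
  · exact check_Nineteen_piece3
  · exact check_Nineteen_piece4
  · exact check_Nineteen_piece5
  · exact check_Nineteen_piece6

/-! ### The theorems -/

/-- **`a*({2,…,19}) ≤ 203/128 = 1.5859375`.** -/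
theorem weilSemilocalThreshold_uptoNineteen_le :
    weilSemilocalThreshold {2, 3, 5, 7, 11, 13, 17, 19} ≤ ((203 / 128 : ℚ) : ℝ) :=
  weilSemilocalThreshold_le_of_checkP_sharp certNineteen atomsEnclose_Nineteen
    check_Nineteen_main check_Nineteen_atoms check_Nineteen_pieces

/-- Failure form: `{∞,2,…,19}`-positivity fails on every cone `C(B)`, `B > 203/128`. -/
theorem not_weilSemilocalPositivityOn_uptoNineteen_of_gt {B : ℝ} (hB : (203 / 128 : ℝ) < B) :
    ¬ WeilSemilocalPositivityOn {2, 3, 5, 7, 11, 13, 17, 19} B := by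
  rw [not_weilSemilocalPositivityOn_iff_weilSemilocalThreshold_lt]
  have h := weilSemilocalThreshold_uptoNineteen_le
  push_cast at h
  linarith

/-- `a*({2,…,19}) < (log 24)/2`: below the window of the next index. -/
theorem weilSemilocalThreshold_uptoNineteen_lt_log_twentyfour_half :
    weilSemilocalThreshold {2, 3, 5, 7, 11, 13, 17, 19} < Real.log 24 / 2 := by
  have h := weilSemilocalThreshold_uptoNineteen_le
  have h2 := Literature.Analysis.SpecialFunctions.Real.log_two_gt_d20
  have h3 := Real.log_three_gt_d9
  have h24 : Real.log 24 = 3 * Real.log 2 + Real.log 3 := by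
    rw [show (24 : ℝ) = 2 ^ 3 * 3 by norm_num, Real.log_mul (by norm_num) (by norm_num), Real.log_pow]; push_cast; ring
  push_cast at h
  rw [h24]
  linarith

/-- **The class `2, …, 19 ∈ S ∌ 23`**: `a*(S) = a*({2,…,19})` (locality at `N = 23`). -/
theorem weilSemilocalThreshold_eq_uptoNineteen {S : Finset ℕ} (h2 : 2 ∈ S) (h3 : 3 ∈ S) (h5 : 5 ∈ S) (h7 : 7 ∈ S)
    (h11 : 11 ∈ S) (h13 : 13 ∈ S) (h17 : 17 ∈ S) (h19 : 19 ∈ S) (h23 : 23 ∉ S) :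
    weilSemilocalThreshold S = weilSemilocalThreshold {2, 3, 5, 7, 11, 13, 17, 19} := by
  refine weilSemilocalThreshold_congr (S := {2, 3, 5, 7, 11, 13, 17, 19}) (S' := S) (N := 23) ?_ ?_
  · intro n hn hpp
    interval_cases n
    · exact absurd hpp (by decide)
    · exact absurd hpp (by decide)
    · rw [Nat.prime_two.primeFactors]; simp [h2]
    · rw [Nat.prime_three.primeFactors]; simp [h3]
    · rw [show (4 : ℕ) = 2 ^ 2 by norm_num, Nat.primeFactors_prime_pow two_ne_zero Nat.prime_two]; simp [h2]
    · rw [(by norm_num : Nat.Prime 5).primeFactors]; simp [h5]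
    · exact absurd hpp (by decide)
    · rw [(by norm_num : Nat.Prime 7).primeFactors]; simp [h7]
    · rw [show (8 : ℕ) = 2 ^ 3 by norm_num, Nat.primeFactors_prime_pow (by norm_num) Nat.prime_two]; simp [h2]
    · rw [show (9 : ℕ) = 3 ^ 2 by norm_num, Nat.primeFactors_prime_pow two_ne_zero Nat.prime_three]; simp [h3]
    · exact absurd hpp (by decide)
    · rw [(by norm_num : Nat.Prime 11).primeFactors]; simp [h11]
    · exact absurd hpp (by decide)
    · rw [(by norm_num : Nat.Prime 13).primeFactors]; simp [h13]
    · exact absurd hpp (by decide)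
    · exact absurd hpp (not_isPrimePow_of_two_primes_dvd Nat.prime_three (by norm_num : Nat.Prime 5) (by norm_num)
        (by norm_num) (by norm_num))
    · rw [show (16 : ℕ) = 2 ^ 4 by norm_num, Nat.primeFactors_prime_pow (by norm_num) Nat.prime_two]; simp [h2]
    · rw [(by norm_num : Nat.Prime 17).primeFactors]; simp [h17]
    · exact absurd hpp (by decide)
    · rw [(by norm_num : Nat.Prime 19).primeFactors]; simp [h19]
    · exact absurd hpp (by decide)
    · exact absurd hpp (not_isPrimePow_of_two_primes_dvd Nat.prime_three (by norm_num : Nat.Prime 7) (by norm_num)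
        (by norm_num) (by norm_num))
    · exact absurd hpp (by decide)
    · rw [(by norm_num : Nat.Prime 23).primeFactors]; simp [h23]
  · have h := weilSemilocalThreshold_uptoNineteen_lt_log_twentyfour_half
    norm_num
    exact h

/-- **`a*(S) ≤ 203/128` for every finite set of primes `S` with `2, …, 19 ∈ S`, `23 ∉ S`.** -/
theorem weilSemilocalThreshold_le_of_mem_nineteen {S : Finset ℕ} (h2 : 2 ∈ S) (h3 : 3 ∈ S) (h5 : 5 ∈ S) (h7 : 7 ∈ S)
    (h11 : 11 ∈ S) (h13 : 13 ∈ S) (h17 : 17 ∈ S) (h19 : 19 ∈ S) (h23 : 23 ∉ S) :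
    weilSemilocalThreshold S ≤ ((203 / 128 : ℚ) : ℝ) := by
  rw [weilSemilocalThreshold_eq_uptoNineteen h2 h3 h5 h7 h11 h13 h17 h19 h23]
  exact weilSemilocalThreshold_uptoNineteen_le

/-- **The bracket of the class `2, …, 19 ∈ S ∌ 23`**: `4023/5000 ≤ a*(S) ≤ 203/128` (DATA `≈ 1.5679`). -/
theorem weilSemilocalThreshold_mem_Icc_of_mem_nineteen {S : Finset ℕ} (h2 : 2 ∈ S) (h3 : 3 ∈ S) (h5 : 5 ∈ S)
    (h7 : 7 ∈ S) (h11 : 11 ∈ S) (h13 : 13 ∈ S) (h17 : 17 ∈ S) (h19 : 19 ∈ S) (h23 : 23 ∉ S) :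
    weilSemilocalThreshold S ∈ Set.Icc (4023 / 5000 : ℝ) ((203 / 128 : ℚ) : ℝ) :=
  ⟨SemilocalTwoThree.le_weilSemilocalThreshold_of_two_three_8046 h2 h3,
    weilSemilocalThreshold_le_of_mem_nineteen h2 h3 h5 h7 h11 h13 h17 h19 h23⟩

end Summit.RiemannHypothesis.RiemannHypothesis.Theorems.SemilocalPolyWitness

end

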